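import Summits.Ventures.CertifiedManyBodySolver.Observables.SpinStarAlgebra

/-!
# The fermion star inequality: a certified lower edge for star-averaged spin correlators

HONEST FRAMING: first certified bounds; not a superconductivity verdict; every number certified or
labelled float.  Exact operator inequalities on every finite lattice / finite torus only (speedrun
`mbsolver`, seat sr-mbsolver-m3-2, gen 9; companion of `SpinCorrelatorRange`, whose lower edge it halves
for shell averages); no thermodynamic-limit instance is typed here.

`SpinCorrelatorRange` proves the two-site range `-(3/8)(m_x + m_y) ≤ 𝐒_x·𝐒_y ≤ ¼ m_x`.  For a centre
`x` and a finite set `Y` of `k = |Y|` OTHER sites of any finite lattice of spin-½ fermions the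
**star operator inequality**
`Σ_{y ∈ Y} 𝐒_x·𝐒_y + ((k + 2)/4) m_x ⪰ 0`
holds (`m_x = n_x - 2 n_{x↑}n_{x↓}` the local moment; `posSemidef_fermionSpinStar`).  For `k = 1` it is
the singlet bound in the form `𝐒_x·𝐒_y + (3/4) m_x ⪰ 0`; for `k ≥ 2` it is sharper than anything the
`k` pairwise bounds give (those cost `(3/8)(m_x + m_y)` per arm, i.e. `(3/4) k` per star on singly
occupied configurations, against `(k + 2)/4` here): it is the fermionic form of Anderson's star bound
`𝐒_0 · Σ_{y∈Y} 𝐒_y ≥ -(1/2)(k/2 + 1)` for spins ½ (a spin ½ coupled to total spin `ℓ ≤ k/2` has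
`𝐒_0·𝐋 ≥ -(ℓ + 1)/2`), in which empty and doubly occupied sites carry no spin.

The proof is purely algebraic (no spectral decomposition).  With `G = Σ_{y∈Y} 𝐒_x·𝐒_y`,
`𝐋² = Σ_{y,y'∈Y} 𝐒_y·𝐒_{y'}` and the on-site algebra of `S^±_x, σ^z_x = n_{x↑} - n_{x↓}` one has the
**star identity** `G² = ¼ m_x 𝐋² - ½ G` (`fermionSpinStar_mul_self`); for `B = G + ((k+2)/4) m_x`
this gives `((k+1)/2) B - B² = ¼ m_x [(k(k+2)/4)·1 - 𝐋²] m_x ⪰ 0` by the tree's Casimir bound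
`𝐋² ≤ ((k+2)/4) Σ_{y∈Y} m_y ≤ k(k+2)/4` (`posSemidef_momentCasimir_sub`), whence
`B = (2/(k+1)) [(((k+1)/2) B - B²) + B†B] ⪰ 0`.

Summed over the `L × L` torus (`spinCorrSum L r = W_r = Σ_x 𝐒_x·𝐒_{x+r}`): for every finite set `R` of
NONZERO displacements, `Σ_{r∈R} W_r + ((|R|+2)/4) Σ_x m_x ⪰ 0`
(`posSemidef_sum_spinCorrSum_add_smul_sum_localMoment`), hence on a unit `N`-particle vector with total
double occupancy `𝒟 = Re⟨ψ, Σ_x n_{x↑}n_{x↓} ψ⟩`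
**`Σ_{r∈R} C_s(r; ψ) ≥ -((|R|+2)/4) (N - 2𝒟)/L²`** (`sum_spinCorr_ge_of_isNParticle`); for a
four-arm star (`R = {±e₁, ±e₂}`, the NN shell, or `R = {±e₁ ± e₂}`, the NNN shell)
`Σ_{r∈R} C_s(r; ψ) ≥ -(3/2)(N - 2𝒟)/L²`, i.e. the shell AVERAGE is `≥ -(3/8)(N - 2𝒟)/L²`
(`sum_spinCorr_ge_of_card_eq_four`) — half the per-displacement lower edge `-(3/4)(N - 2𝒟)/L²` of
`spinCorr_mem_Icc_of_isNParticle`.  At filling `n = 7/8` this is `-21/64 + (3/4)·(𝒟/L²)` per site for the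
NN- and NNN-shell averages (exact; any certified lower bound on the double occupancy sharpens it).  When
the four arms carry the same value (e.g. a `D₄`-invariant expectation, as for the point-group orbit
averages the TL rows of record bound) the single NN or NNN correlator itself obeys
`C_s(r; ψ) ≥ -(3/8)(N - 2𝒟)/L²` (`spinCorr_ge_of_eq_on_card_four`).

References: P. W. Anderson, Phys. Rev. 83 (1951) 1260 (the star bound for spins);
[Tasaki2020, App. A.3] (addition of angular momenta, `(𝐒_0 + 𝐒_Y)² ≥ (ℓ - ½)(ℓ + ½)`);
[EsslerEtAl2005, §2.2.5] (the local spin and moment operators of the Hubbard model).  The tree inputs are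
`posSemidef_momentCasimir_sub`, `localMoment_eq_sq`, `fermionSpinPlus_mul_fermionSpinMinus` and the CAR
commutator `LiebThm1.creation_mul_annihilation_commutator`; the on-site multiplication table, the
inter-site commutations, the `su(2)` relations of the partial sums over `Y` and the abstract star
identity `SpinStar.star_core` are in `SpinStarAlgebra`.
-/

namespace Summit.Ventures.CertifiedManyBodySolver.Observables

open Matrix Literature.MathematicalPhysics.QuantumLattice Literature.Probability.LatticeModels
open Literature.MathematicalPhysics.QuantumLattice.HubbardWave0
open Literature.MathematicalPhysics.QuantumLattice.FermionTorus
open Literature.MathematicalPhysics.QuantumLattice.FermionSpinMoment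
open scoped BigOperators ComplexConjugate ComplexOrder

namespace SpinStar

/-! ### From the star identity to positivity (abstract) -/

/-- **From the star identity to positivity, abstract form.**  If `G, m, L2` are matrices with
`G† = G`, `m† = m = m²`, `G m = m G = G`, `[L2, m] = 0`, the star identity `G² = ¼ m L2 - ½ G`, and
the Casimir ceiling `L2 ≤ k(k+2)/4`, then `G + ((k+2)/4) m ⪰ 0`:
`((k+1)/2) B - B² = ¼ m† [(k(k+2)/4)·1 - L2] m ⪰ 0` and `B² = B†B ⪰ 0` for `B = G + ((k+2)/4) m`. -/
theorem posSemidef_of_starIdentity {n : Type*} [Fintype n] [DecidableEq n]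
    {G m L2 : Matrix n n ℂ} {k : ℕ}
    (hGh : Gᴴ = G) (hmh : mᴴ = m) (hmm : m * m = m) (hGm : G * m = G) (hmG : m * G = G)
    (hL2m : L2 * m = m * L2) (hGG : G * G = (1 / 4 : ℂ) • (m * L2) - (1 / 2 : ℂ) • G)
    (hD : ((((k : ℂ) * ((k : ℂ) + 2)) / 4) • (1 : Matrix n n ℂ) - L2).PosSemidef) :
    (G + (((k : ℂ) + 2) / 4) • m).PosSemidef := by
  set B := G + (((k : ℂ) + 2) / 4) • m with hB
  have hc : (((k : ℂ) + 2) / 4) = ((((k : ℝ) + 2) / 4 : ℝ) : ℂ) := by push_cast; ring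
  have hcstar : star (((k : ℂ) + 2) / 4) = ((k : ℂ) + 2) / 4 := by
    rw [hc]
    exact Complex.conj_ofReal _
  have hBh : Bᴴ = B := by
    rw [hB, conjTranspose_add, conjTranspose_smul, hGh, hmh, hcstar]
  have lhs : (((k : ℂ) + 1) / 2) • B - B * B =
      (((k : ℂ) * ((k : ℂ) + 2)) / 16) • m - (1 / 4 : ℂ) • (m * L2) := by
    rw [hB]
    simp only [add_mul, mul_add, smul_mul_assoc, mul_smul_comm, hGG, hGm, hmG, hmm]
    module
  have rhs : (1 / 4 : ℂ) • (mᴴ * (((((k : ℂ) * ((k : ℂ) + 2)) / 4) • (1 : Matrix n n ℂ) - L2)) * m) =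
      (((k : ℂ) * ((k : ℂ) + 2)) / 16) • m - (1 / 4 : ℂ) • (m * L2) := by
    rw [hmh, mul_sub, sub_mul, mul_smul_comm, mul_one, smul_mul_assoc, mul_assoc, hL2m, ← mul_assoc, hmm]
    module
  have quarter_nonneg : (0 : ℂ) ≤ 1 / 4 := by
    rw [show (1 / 4 : ℂ) = ((1 / 4 : ℝ) : ℂ) by norm_num]
    exact Complex.zero_le_real.2 (by norm_num)
  have h1 : ((((k : ℂ) + 1) / 2) • B - B * B).PosSemidef := by
    rw [lhs, ← rhs]
    exact (hD.conjTranspose_mul_mul_same m).smul quarter_nonneg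
  have h2 : (B * B).PosSemidef := by
    have h := posSemidef_conjTranspose_mul_self B
    rwa [hBh] at h
  have h3 : ((((k : ℂ) + 1) / 2) • B).PosSemidef := by
    have h := h1.add h2
    rwa [sub_add_cancel] at h
  have hk : ((k : ℂ) + 1) ≠ 0 := Nat.cast_add_one_ne_zero k
  have hscale : B = ((2 : ℂ) / ((k : ℂ) + 1)) • ((((k : ℂ) + 1) / 2) • B) := by
    rw [smul_smul, show (2 : ℂ) / ((k : ℂ) + 1) * (((k : ℂ) + 1) / 2) = 1 by field_simp, one_smul]
  have hpos : (0 : ℂ) ≤ (2 : ℂ) / ((k : ℂ) + 1) := by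
    rw [show (2 : ℂ) / ((k : ℂ) + 1) = (((2 : ℝ) / ((k : ℝ) + 1) : ℝ) : ℂ) by push_cast; ring]
    exact Complex.zero_le_real.2 (by positivity)
  rw [hscale]
  exact h3.smul hpos

section Local

variable {Λ : Type*} [LinearOrder Λ] [Fintype Λ]

/-! ### The star identity and the star inequality -/

/-- `𝐒_x·𝐒_y = ½ S⁺_x S⁻_y + ½ S⁻_x S⁺_y + ¼ σ^z_x σ^z_y`. -/
theorem fermionSpinDot_eq_sigmaZ (x y : Λ) :
    fermionSpinDot x y = (1 / 2 : ℂ) • (fermionSpinPlus x * fermionSpinMinus y) +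
      (1 / 2 : ℂ) • (fermionSpinMinus x * fermionSpinPlus y) +
        (1 / 4 : ℂ) • ((numberOp x 0 - numberOp x 1) * (numberOp y 0 - numberOp y 1)) := by
  rw [fermionSpinDot_def, fermionSpinZ_def, fermionSpinZ_def, smul_mul_smul_comm]
  module

/-- `Σ_{y∈Y} 𝐒_x·𝐒_y = ¼ (2 S⁺_x Σ_Y S⁻ + 2 S⁻_x Σ_Y S⁺ + σ^z_x Σ_Y σ^z)`. -/
theorem sum_fermionSpinDot_eq (x : Λ) (Y : Finset Λ) :
    ∑ y ∈ Y, fermionSpinDot x y = (1 / 4 : ℂ) •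
      (fermionSpinPlus x * (∑ y ∈ Y, fermionSpinMinus y) + fermionSpinPlus x * (∑ y ∈ Y, fermionSpinMinus y) +
        (fermionSpinMinus x * (∑ y ∈ Y, fermionSpinPlus y) + fermionSpinMinus x * (∑ y ∈ Y, fermionSpinPlus y)) +
        (numberOp x 0 - numberOp x 1) * ∑ y ∈ Y, (numberOp y 0 - numberOp y 1)) := by
  simp only [fermionSpinDot_eq_sigmaZ, Finset.sum_add_distrib, ← Finset.smul_sum, ← Finset.mul_sum]
  module

/-- `Σ_{y,y'∈Y} 𝐒_y·𝐒_{y'} = ¼ (2 Σ_Y S⁺ Σ_Y S⁻ + 2 Σ_Y S⁻ Σ_Y S⁺ + (Σ_Y σ^z)²)`. -/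
theorem sum_sum_fermionSpinDot_eq (Y : Finset Λ) :
    ∑ y ∈ Y, ∑ y' ∈ Y, fermionSpinDot y y' = (1 / 4 : ℂ) •
      ((∑ y ∈ Y, fermionSpinPlus y) * (∑ y ∈ Y, fermionSpinMinus y) +
          (∑ y ∈ Y, fermionSpinPlus y) * (∑ y ∈ Y, fermionSpinMinus y) +
        ((∑ y ∈ Y, fermionSpinMinus y) * (∑ y ∈ Y, fermionSpinPlus y) +
          (∑ y ∈ Y, fermionSpinMinus y) * (∑ y ∈ Y, fermionSpinPlus y)) +
        (∑ y ∈ Y, (numberOp y 0 - numberOp y 1)) * ∑ y ∈ Y, (numberOp y 0 - numberOp y 1)) := by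
  simp only [fermionSpinDot_eq_sigmaZ, Finset.sum_add_distrib, ← Finset.smul_sum, ← Finset.mul_sum,
    ← Finset.sum_mul]
  module

/-- **The star identity** `G² = ¼ m_x 𝐋² - ½ G` for `G = Σ_{y∈Y} 𝐒_x·𝐒_y`, `x ∉ Y`,
`𝐋² = Σ_{y,y'∈Y} 𝐒_y·𝐒_{y'}` (the fermionic form of `(𝐒_0·𝐋)² = ¼ 𝐋² - ½ 𝐒_0·𝐋` for a spin ½). -/
theorem fermionSpinStar_mul_self {x : Λ} {Y : Finset Λ} (hx : x ∉ Y) :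
    (∑ y ∈ Y, fermionSpinDot x y) * (∑ y ∈ Y, fermionSpinDot x y) =
      (1 / 4 : ℂ) • (localMoment x * ∑ y ∈ Y, ∑ y' ∈ Y, fermionSpinDot y y') -
        (1 / 2 : ℂ) • ∑ y ∈ Y, fermionSpinDot x y := by
  have hne : ∀ y ∈ Y, x ≠ y := fun y hy => (ne_of_mem_of_not_mem hy hx).symm
  have core := star_core (fermionSpinPlus x) (fermionSpinMinus x) (numberOp x 0 - numberOp x 1) (localMoment x)
    (∑ y ∈ Y, fermionSpinPlus y) (∑ y ∈ Y, fermionSpinMinus y) (∑ y ∈ Y, (numberOp y 0 - numberOp y 1))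
    (fermionSpinPlus_mul_self x) (fermionSpinMinus_mul_self x) (fermionSpinPlus_mul_fermionSpinMinus_add x)
    (fermionSpinPlus_mul_fermionSpinMinus_sub x) (sigmaZ_mul_fermionSpinPlus x) (fermionSpinPlus_mul_sigmaZ x)
    (sigmaZ_mul_fermionSpinMinus x) (fermionSpinMinus_mul_sigmaZ x) (localMoment_eq_sq x).symm
    (Commute.sum_right _ _ _ fun y hy => fermionSpinPlus_commute_fermionSpinPlus (hne y hy)).eq.symm
    (Commute.sum_right _ _ _ fun y hy => fermionSpinPlus_commute_fermionSpinMinus (hne y hy)).eq.symm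
    (Commute.sum_right _ _ _ fun y hy => (sigmaZ_commute_fermionSpinPlus (hne y hy).symm).symm).eq.symm
    (Commute.sum_right _ _ _ fun y hy => fermionSpinMinus_commute_fermionSpinPlus (hne y hy)).eq.symm
    (Commute.sum_right _ _ _ fun y hy => fermionSpinMinus_commute_fermionSpinMinus (hne y hy)).eq.symm
    (Commute.sum_right _ _ _ fun y hy => (sigmaZ_commute_fermionSpinMinus (hne y hy).symm).symm).eq.symm
    (Commute.sum_right _ _ _ fun y hy => sigmaZ_commute_fermionSpinPlus (hne y hy)).eq.symm
    (Commute.sum_right _ _ _ fun y hy => sigmaZ_commute_fermionSpinMinus (hne y hy)).eq.symm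
    (Commute.sum_right _ _ _ fun y hy => sigmaZ_commute_sigmaZ x y).eq.symm
    (by rw [← neg_sub, sum_fermionSpinPlus_comm_sum_fermionSpinMinus])
    (by rw [← neg_sub, sum_sigmaZ_comm_sum_fermionSpinPlus])
    (sum_sigmaZ_comm_sum_fermionSpinMinus Y)
  rw [sum_fermionSpinDot_eq x Y, sum_sum_fermionSpinDot_eq Y]
  simp only [smul_mul_assoc, mul_smul_comm, smul_smul]
  rw [core]
  module

/-- **The fermion star inequality**: `Σ_{y∈Y} 𝐒_x·𝐒_y + ((|Y|+2)/4) m_x ⪰ 0` for `x ∉ Y`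
(Anderson's star bound `𝐒_0·Σ_Y 𝐒_y ≥ -½(|Y|/2 + 1)`, in the fermionic form where empty and doubly
occupied sites carry no spin). -/
theorem posSemidef_fermionSpinStar {x : Λ} {Y : Finset Λ} (hx : x ∉ Y) :
    (∑ y ∈ Y, fermionSpinDot x y + (((Y.card : ℂ) + 2) / 4) • localMoment x).PosSemidef := by
  have hne : ∀ y ∈ Y, x ≠ y := fun y hy => (ne_of_mem_of_not_mem hy hx).symm
  have hc : (0 : ℂ) ≤ ((Y.card : ℂ) + 2) / 4 := by
    rw [show ((Y.card : ℂ) + 2) / 4 = ((((Y.card : ℝ) + 2) / 4 : ℝ) : ℂ) by push_cast; ring]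
    exact Complex.zero_le_real.2 (by positivity)
  refine posSemidef_of_starIdentity (k := Y.card) (L2 := ∑ y ∈ Y, ∑ y' ∈ Y, fermionSpinDot y y') ?_
    (isHermitian_localMoment x).eq (localMoment_mul_self x) ?_ ?_ ?_ (fermionSpinStar_mul_self hx) ?_
  · rw [conjTranspose_sum]
    exact Finset.sum_congr rfl fun y _ => (isHermitian_fermionSpinDot x y).eq
  · rw [Finset.sum_mul]
    exact Finset.sum_congr rfl fun y hy => fermionSpinDot_mul_localMoment_left (hne y hy)
  · rw [Finset.mul_sum]
    exact Finset.sum_congr rfl fun y hy => localMoment_mul_fermionSpinDot_left (hne y hy)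
  · exact (Commute.sum_right _ _ _ fun y hy => Commute.sum_right _ _ _ fun y' hy' =>
      localMoment_commute_fermionSpinDot (hne y hy) (hne y' hy')).eq.symm
  · -- the Casimir ceiling `𝐋² ≤ ((|Y|+2)/4) Σ_Y m_y ≤ |Y|(|Y|+2)/4`
    have h1 : (∑ y ∈ Y, ((1 : Matrix (Finset (Orb Λ)) (Finset (Orb Λ)) ℂ) - localMoment y)).PosSemidef := by
      refine posSemidef_finset_sum Y fun y _ => ?_
      rw [localMoment_eq_diagonal, ← diagonal_one, diagonal_sub, posSemidef_diagonal_iff]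
      intro s
      rcases localMomentFun_mem y s with h | h <;> simp [h]
    have h := (h1.smul hc).add (posSemidef_momentCasimir_sub Y)
    convert h using 1
    rw [Finset.sum_sub_distrib, Finset.sum_const, ← Nat.cast_smul_eq_nsmul ℂ]
    module

end Local

/-! ### On the `L × L` torus: stars of displacements and the per-site correlator -/

section Torus

variable (L : ℕ) [NeZero L]

omit [NeZero L] in
/-- PSD ⇒ nonnegative real expectation. -/
private theorem re_expect_nonneg_of_posSemidef
    {P : Matrix (Finset (Orb (FermionTorus 2 L))) (Finset (Orb (FermionTorus 2 L))) ℂ}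
    (hP : P.PosSemidef) (ψ : Fock (Orb (FermionTorus 2 L))) : 0 ≤ (expect P ψ).re := by
  obtain ⟨hre, -⟩ := Complex.nonneg_iff.mp (hP.dotProduct_mulVec_nonneg ψ)
  simpa [expect] using hre

/-- **Star operator bound on the torus**: for a finite set `R` of nonzero displacements,
`Σ_{r∈R} W_r + ((|R|+2)/4) Σ_x m_x ⪰ 0` (sum over centres `x` of the star inequality for the star
`{x + r : r ∈ R}`). -/
theorem posSemidef_sum_spinCorrSum_add_smul_sum_localMoment {R : Finset (TorusSite 2 L)}
    (h0 : (0 : TorusSite 2 L) ∉ R) :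
    (∑ r ∈ R, spinCorrSum L r + (((R.card : ℂ) + 2) / 4) • ∑ x : TorusSite 2 L,
      (localMoment (ofTorusSite x) : Matrix (Finset (Orb (FermionTorus 2 L))) (Finset (Orb (FermionTorus 2 L))) ℂ)).PosSemidef := by
  classical
  have hstar : ∀ x : TorusSite 2 L, (∑ r ∈ R, fermionSpinDot (ofTorusSite x) (ofTorusSite (x + r)) +
      (((R.card : ℂ) + 2) / 4) • (localMoment (ofTorusSite x) :
        Matrix (Finset (Orb (FermionTorus 2 L))) (Finset (Orb (FermionTorus 2 L))) ℂ)).PosSemidef := by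
    intro x
    have hinj : Set.InjOn (fun r : TorusSite 2 L => ofTorusSite (L := L) (x + r)) R := by
      intro r _ r' _ h
      have h1 : ofTorusSite (L := L) (x + r) = ofTorusSite (x + r') := h
      have h2 : x + r = x + r' := (FermionTorus.equivTorusSite (d := 2) (L := L)).symm.injective h1
      exact add_left_cancel h2
    have hx : ofTorusSite x ∉ R.image fun r : TorusSite 2 L => ofTorusSite (L := L) (x + r) := by
      rw [Finset.mem_image]
      rintro ⟨r, hr, h⟩
      exact ofTorusSite_ne_ofTorusSite_add L (ne_of_mem_of_not_mem hr h0) x h.symm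
    have h := posSemidef_fermionSpinStar hx
    rwa [Finset.sum_image hinj, Finset.card_image_of_injOn hinj] at h
  have hsum : ∑ r ∈ R, spinCorrSum L r =
      ∑ x : TorusSite 2 L, ∑ r ∈ R, fermionSpinDot (ofTorusSite x) (ofTorusSite (x + r)) := by
    simp only [spinCorrSum]
    exact Finset.sum_comm
  rw [hsum, Finset.smul_sum, ← Finset.sum_add_distrib]
  exact posSemidef_finset_sum Finset.univ fun x _ => hstar x

/-- **`Σ_{r∈R} C_s(r; ψ) ≥ -((|R|+2)/4)(N - 2𝒟)/L²`** on a unit `N`-particle vector, for a finite set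
`R` of nonzero displacements (`𝒟 = Re⟨ψ, Σ_x n_{x↑}n_{x↓} ψ⟩` the total double occupancy). -/
theorem sum_spinCorr_ge_of_isNParticle {R : Finset (TorusSite 2 L)} (h0 : (0 : TorusSite 2 L) ∉ R)
    {N : ℕ} {ψ : Fock (Orb (FermionTorus 2 L))} (hψ : IsNParticle N ψ) (hnorm : star ψ ⬝ᵥ ψ = 1) :
    -(((R.card : ℝ) + 2) / 4) * ((N : ℝ) - 2 * (expect (∑ x : TorusSite 2 L,
        (numberOp (ofTorusSite x) 0 * numberOp (ofTorusSite x) 1 :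
          Matrix (Finset (Orb (FermionTorus 2 L))) (Finset (Orb (FermionTorus 2 L))) ℂ)) ψ).re) / (L : ℝ) ^ 2 ≤
      ∑ r ∈ R, spinCorr L r ψ := by
  have hL : (0 : ℝ) < (L : ℝ) ^ 2 := by
    have : (0 : ℝ) < (L : ℝ) := by exact_mod_cast Nat.pos_of_ne_zero (NeZero.ne L)
    positivity
  have hm : (expect (∑ x : TorusSite 2 L, (localMoment (ofTorusSite x) :
        Matrix (Finset (Orb (FermionTorus 2 L))) (Finset (Orb (FermionTorus 2 L))) ℂ)) ψ).re =
      (N : ℝ) - 2 * (expect (∑ x : TorusSite 2 L, (numberOp (ofTorusSite x) 0 * numberOp (ofTorusSite x) 1 :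
          Matrix (Finset (Orb (FermionTorus 2 L))) (Finset (Orb (FermionTorus 2 L))) ℂ)) ψ).re := by
    rw [sum_localMoment_eq L, expect_add, expect_smul, Complex.add_re,
      re_expect_sum_siteDensity_of_isNParticle L hψ, hnorm, show (-2 : ℂ) = ((-2 : ℝ) : ℂ) by norm_num,
      Complex.re_ofReal_mul]
    simp only [Complex.one_re, mul_one]
    ring
  have h := re_expect_nonneg_of_posSemidef L (posSemidef_sum_spinCorrSum_add_smul_sum_localMoment L h0) ψ
  rw [expect_add, expect_smul, expect_sum, Complex.add_re, Complex.re_sum,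
    show ((R.card : ℂ) + 2) / 4 = ((((R.card : ℝ) + 2) / 4 : ℝ) : ℂ) by push_cast; ring,
    Complex.re_ofReal_mul, hm] at h
  unfold spinCorr
  rw [← Finset.sum_div, div_le_div_iff_of_pos_right hL]
  linarith

/-- **Four-arm stars** (`|R| = 4`, e.g. the NN shell `{±e₁, ±e₂}` or the NNN shell `{±e₁ ± e₂}`):
`Σ_{r∈R} C_s(r; ψ) ≥ -(3/2)(N - 2𝒟)/L²`, i.e. the shell average is `≥ -(3/8)(N - 2𝒟)/L²` — half the
per-displacement lower edge `-(3/4)(N - 2𝒟)/L²` of `spinCorr_mem_Icc_of_isNParticle`. -/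
theorem sum_spinCorr_ge_of_card_eq_four {R : Finset (TorusSite 2 L)} (h0 : (0 : TorusSite 2 L) ∉ R)
    (hR : R.card = 4) {N : ℕ} {ψ : Fock (Orb (FermionTorus 2 L))} (hψ : IsNParticle N ψ)
    (hnorm : star ψ ⬝ᵥ ψ = 1) :
    -(3 / 2 : ℝ) * ((N : ℝ) - 2 * (expect (∑ x : TorusSite 2 L,
        (numberOp (ofTorusSite x) 0 * numberOp (ofTorusSite x) 1 :
          Matrix (Finset (Orb (FermionTorus 2 L))) (Finset (Orb (FermionTorus 2 L))) ℂ)) ψ).re) / (L : ℝ) ^ 2 ≤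
      ∑ r ∈ R, spinCorr L r ψ := by
  have h := sum_spinCorr_ge_of_isNParticle L h0 hψ hnorm
  have hc : ((R.card : ℝ) + 2) / 4 = 3 / 2 := by
    rw [hR]
    norm_num
  rwa [hc] at h

/-- **Equal arms** (`|R| = 4` and `C_s(r; ψ)` the same for all `r ∈ R`, e.g. a `D₄`-invariant
expectation): the single correlator obeys `C_s(r₀; ψ) ≥ -(3/8)(N - 2𝒟)/L²`. -/
theorem spinCorr_ge_of_eq_on_card_four {R : Finset (TorusSite 2 L)} (h0 : (0 : TorusSite 2 L) ∉ R)
    (hR : R.card = 4) {N : ℕ} {ψ : Fock (Orb (FermionTorus 2 L))} (hψ : IsNParticle N ψ)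
    (hnorm : star ψ ⬝ᵥ ψ = 1) {r₀ : TorusSite 2 L}
    (hconst : ∀ r ∈ R, spinCorr L r ψ = spinCorr L r₀ ψ) :
    -(3 / 8 : ℝ) * ((N : ℝ) - 2 * (expect (∑ x : TorusSite 2 L,
        (numberOp (ofTorusSite x) 0 * numberOp (ofTorusSite x) 1 :
          Matrix (Finset (Orb (FermionTorus 2 L))) (Finset (Orb (FermionTorus 2 L))) ℂ)) ψ).re) / (L : ℝ) ^ 2 ≤
      spinCorr L r₀ ψ := by
  have h := sum_spinCorr_ge_of_card_eq_four L h0 hR hψ hnorm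
  rw [Finset.sum_congr rfl hconst, Finset.sum_const, hR, nsmul_eq_mul, Nat.cast_ofNat,
    show -(3 / 2 : ℝ) = 4 * -(3 / 8 : ℝ) by norm_num, mul_assoc, mul_div_assoc] at h
  exact le_of_mul_le_mul_left h (by norm_num)

end Torus

end SpinStar

end Summit.Ventures.CertifiedManyBodySolver.Observables
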